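import Literature.AlgebraicGeometry.Motives.ProjectiveSpaceConstantFieldExtensions
import HarnessLib

/-!
# `Z(X ⊗ 𝔽_{q^m}, T)` has NEITHER POLE NOR ZERO off the Weil weights: order `0` at `(q^m)^{−r}` for `r > dim X`,
# at every `t₀` with `|t₀| > 1`, and at every `t₀` with `|t₀| < (q^m)^{−dim X}`; the top and bottom poles of
# `Z((X × ℙⁿ) ⊗ 𝔽_{q^m}, T)`

Topic `Literature/AlgebraicGeometry/Motives`; THEOREMS ONLY (no definition, no instance, no named fact; D-0026).
The tree's `IsWeilFactorization.hasPoleOfOrderAt` (`Motives/ZetaFunctionPoleOrderTateConjecture`) gives the EXACT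
pole order `mult_{q^{−r}} P_{2r}` of a Weil factorisation at `q^{−r}` for `r ≤ n`; `hasPoleOfOrderAt_zetaSeriesPow`
(`Motives/ZetaFunctionConstantFieldExtensionPoleOrder`) reads it in cohomology. This file adds the complementary
RIEMANN-HYPOTHESIS statements «no factor `Pᵢ` vanishes off `|t| = q^{−i/2}`» in the `HasPoleOfOrderAt` language
(order `0` = holomorphic and non-vanishing), for `Z(X)` and for all `Z(X ⊗ 𝔽_{q^m})`, and uses them with the pole
calculus of g52-#8 (`Motives/ProjectiveSpaceConstantFieldExtensions`) on `X × ℙⁿ`.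

* §1 (Weil factorisations `Z·∏_{even}Pᵢ = ∏_{odd}Pᵢ`, `|roots of Pᵢ| = q^{−i/2}`):
  **`IsWeilFactorization.hasPoleOfOrderAt_zero_of_eval_ne_zero`** (order `0` at any `t₀` where no `Pᵢ` vanishes),
  **`IsWeilFactorization.eval_ne_zero_of_norm_ne`** (`‖t₀‖ ≠ q^{−i/2} ⟹ Pᵢ(t₀) ≠ 0`),
  **`IsWeilFactorization.hasPoleOfOrderAt_of_lt`** (order `0` at `q^{−r}`, `r > n`),
  **`IsWeilFactorization.hasPoleOfOrderAt_of_one_lt_abs`** (order `0` at `|t₀| > 1`),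
  **`IsWeilFactorization.hasPoleOfOrderAt_of_abs_lt`** (order `0` at `|t₀| < q^{−n}`).
* §2 (`E` with the trace formula, `χ(φ) = q`, RH for `X` of dimension `d`): `GaloisWeilCohomology.hasPoleOfOrderAt_zetaSeries_of_dim_lt`,
  **`hasPoleOfOrderAt_zetaSeriesPow_of_dim_lt`** (`ord_{(q^m)^{−r}} Z(X ⊗ 𝔽_{q^m}) = 0` for `r > d`, every `m ≥ 1`),
  `hasPoleOfOrderAt_zetaSeries{,Pow}_of_one_lt_abs`, `hasPoleOfOrderAt_zetaSeries{,Pow}_of_abs_lt`.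
* §3 (applications, `X × ℙⁿ` over `𝔽_{q^m}`): **`hasPoleOfOrderAt_zetaSeriesPow_tensor_projectiveSpace_top`**
  (`ord_{(q^m)^{−(d+n)}} Z_m(X × ℙⁿ) = ord_{(q^m)^{−d}} Z_m(X) = dim H^{2d}(X)(d)_{(φ_d(Fᵐ)),1}` — only the summand
  `i = n` of g52-#8's `Σ_{i≤n} ord_{(q^m)ⁱt₀} Z_m(X)` survives), **`hasPoleOfOrderAt_zetaSeriesPow_tensor_projectiveSpace_one`**
  (`ord_{T=1} Z_m(X × ℙⁿ) = ord_{T=1} Z_m(X) = dim H⁰(X)_{(φ₀(Fᵐ)),1}` — only `i = 0` survives),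
  `hasPoleOfOrderAt_zetaSeriesPow_tensor_projectiveSpace_of_lt` (order `0` at `(q^m)^{−r}`, `r > d + n`).

HC is not touched.

## References

* [Deligne1974] P. Deligne, La conjecture de Weil. I, Publ. Math. IHÉS 43 (1974), (1.5.4) and Th. (1.6).
* [Kahn2020] B. Kahn, Zeta and L-Functions of Varieties and Motives (2020), §6.14 Conj. 6.52 («due to the Riemann
  hypothesis» for the case `i = 0`); Prop. 2.3 (4), (5).
* [Milne2012AddendumZetaValues] J. S. Milne, N. Ramachandran, addendum on zeta values (2012), §0.4 (orders of poles).
* [TateWoodsHole1965] J. Tate, Algebraic cycles and poles of zeta functions (1965), §3.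
* [Stichtenoth2009] H. Stichtenoth, Algebraic Function Fields and Codes (2009), Thm. 5.1.15 (e), (f).
* Tree: `Motives/ZetaFunctionPoleOrderTateConjecture` (`IsWeilFactorization.eval_ne_zero_of_ne`, `.hasPoleOfOrderAt`),
  `Motives/ZetaFunctionConstantFieldExtension` (`isWeilFactorization_pow`), `Motives/ZetaFunctionConstantFieldExtensionPoleOrder`
  (`hasPoleOfOrderAt_zetaSeriesPow`), `LFunctions/WeilConjecturesFactorizationProofs` (`isWeilFactorization_of_isIntegralModel`),
  `Motives/ProjectiveSpaceConstantFieldExtensions` (g52-#8: `HasPoleOfOrderAt.prod/.rescale`,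
  `hasPoleOfOrderAt_zetaSeriesPow_tensor_projectiveSpace`).

## Provenance

Lane `lit-hodgefound` (summit `HodgeConjecture`, Track 2 foundations library, Layer B: motives ∕ varieties over finite
fields), seat `lit-hodgefound-p29` (literature-prover, generation 52, row g52-#10).
-/

universe u v

open Polynomial Finset CategoryTheory MonoidalCategory AlgebraicGeometry
open Literature.AlgebraicGeometry.Kahn2003 (HasPoleOfOrderAt)
open Literature.NumberTheory.LFunctions (isWeilFactorization_of_isIntegralModel)

noncomputable section

namespace Literature.AlgebraicGeometry.Motives

/-! ### §1 Weil factorisations: order `0` away from the weights -/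

namespace IsWeilFactorization

variable {q n : ℕ} {Z : PowerSeries ℚ} {P : Fin (2 * n + 1) → ℤ[X]}

/-- Coercion of a product of polynomials to power series (private plumbing). [folklore] -/
private theorem coe_prod' (s : Finset (Fin (2 * n + 1))) (Q : Fin (2 * n + 1) → ℚ[X]) :
    ((∏ i ∈ s, Q i : ℚ[X]) : PowerSeries ℚ) = ∏ i ∈ s, (Q i : PowerSeries ℚ) := by
  rw [← Polynomial.coeToPowerSeries.ringHom_apply, map_prod]
  simp only [Polynomial.coeToPowerSeries.ringHom_apply]

/-- **Order `0` where no factor vanishes**: if `Z·∏_{i even} Pᵢ = ∏_{i odd} Pᵢ` is a Weil factorisation and no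
`Pᵢ` vanishes at `t₀ ∈ ℚ`, then `Z` has neither pole nor zero at `t₀` (`Z·B·(T − t₀)⁰ = A` with `A = ∏_{odd} Pᵢ`,
`B = ∏_{even} Pᵢ`, `A(t₀)B(t₀) ≠ 0`). [cite: Milne2012AddendumZetaValues, §0.4] [cite: Deligne1974, (1.5.4)] -/
theorem hasPoleOfOrderAt_zero_of_eval_ne_zero (hW : IsWeilFactorization q n Z P) {t₀ : ℚ}
    (h : ∀ i : Fin (2 * n + 1), ((P i).map (Int.castRingHom ℚ)).eval t₀ ≠ 0) : HasPoleOfOrderAt Z t₀ 0 := by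
  classical
  refine ⟨∏ i ∈ (Finset.univ : Finset (Fin (2 * n + 1))) with Odd i.val, (P i).map (Int.castRingHom ℚ),
    ∏ i ∈ (Finset.univ : Finset (Fin (2 * n + 1))) with Even i.val, (P i).map (Int.castRingHom ℚ), ?_, ?_, ?_⟩
  · rw [eval_prod]
    exact Finset.prod_ne_zero_iff.mpr fun i _ => h i
  · rw [eval_prod]
    exact Finset.prod_ne_zero_iff.mpr fun i _ => h i
  · rw [pow_zero, mul_one, coe_prod', coe_prod']
    exact hW.2.1

/-- **`‖t₀‖ ≠ q^{−i/2} ⟹ Pᵢ(t₀) ≠ 0`** (the Riemann hypothesis: every complex root of `Pᵢ` has absolute value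
`q^{−i/2}`). [cite: Deligne1974, Th. (1.6)] -/
theorem eval_ne_zero_of_norm_ne (hW : IsWeilFactorization q n Z P) {t₀ : ℚ} (i : Fin (2 * n + 1))
    (ht : ‖(algebraMap ℚ ℂ t₀)‖ ≠ (q : ℝ) ^ (-((i : ℕ) : ℝ) / 2)) :
    ((P i).map (Int.castRingHom ℚ)).eval t₀ ≠ 0 := by
  intro h0
  have hroot : ((P i).map (Int.castRingHom ℂ)).IsRoot (algebraMap ℚ ℂ t₀) := by
    have hcomp : (algebraMap ℚ ℂ).comp (Int.castRingHom ℚ) = Int.castRingHom ℂ := RingHom.ext_int _ _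
    rw [IsRoot.def, ← hcomp, ← Polynomial.map_map, Polynomial.eval_map, Polynomial.eval₂_hom, h0, map_zero]
  exact ht (hW.2.2.2.2 i _ hroot)

/-- **No pole and no zero at `q^{−r}` beyond the dimension (`r > n`)**: `|q^{−r}| = q^{−i/2}` would force
`i = 2r > 2n`. [cite: Deligne1974, Th. (1.6)] [cite: Kahn2020, §6.14 Conj. 6.52] [cite: TateWoodsHole1965, §3] -/
theorem hasPoleOfOrderAt_of_lt (hq : 1 < q) (hW : IsWeilFactorization q n Z P) {r : ℕ} (hr : n < r) :
    HasPoleOfOrderAt Z (((q : ℚ) ^ r)⁻¹) 0 :=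
  hW.hasPoleOfOrderAt_zero_of_eval_ne_zero fun i => hW.eval_ne_zero_of_ne hq i (by have := i.isLt; omega)

/-- The norm of a rational number in `ℂ` is its real absolute value (private plumbing). [folklore] -/
private theorem norm_algebraMap_rat_complex' (t₀ : ℚ) : ‖(algebraMap ℚ ℂ t₀)‖ = |(t₀ : ℝ)| := by
  rw [eq_ratCast, Complex.norm_ratCast]

/-- **No pole and no zero at `|t₀| > 1`** (all the weights `q^{−i/2}` are `≤ 1`). [cite: Deligne1974, Th. (1.6)]
[cite: Stichtenoth2009, Theorem 5.1.15 (e)] -/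
theorem hasPoleOfOrderAt_of_one_lt_abs (hq : 1 < q) (hW : IsWeilFactorization q n Z P) {t₀ : ℚ}
    (ht : 1 < |t₀|) : HasPoleOfOrderAt Z t₀ 0 := by
  refine hW.hasPoleOfOrderAt_zero_of_eval_ne_zero fun i => hW.eval_ne_zero_of_norm_ne i ?_
  have hq1 : (1 : ℝ) ≤ q := by exact_mod_cast hq.le
  have hle : (q : ℝ) ^ (-((i : ℕ) : ℝ) / 2) ≤ 1 :=
    Real.rpow_le_one_of_one_le_of_nonpos hq1
      (by have : (0 : ℝ) ≤ ((i : ℕ) : ℝ) := Nat.cast_nonneg _; linarith)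
  have h1 : (1 : ℝ) < ‖(algebraMap ℚ ℂ t₀)‖ := by
    rw [norm_algebraMap_rat_complex']
    exact_mod_cast ht
  exact (hle.trans_lt h1).ne'

/-- **No pole and no zero at `|t₀| < q^{−n}`** (all the weights `q^{−i/2}`, `i ≤ 2n`, are `≥ q^{−n}`).
[cite: Deligne1974, Th. (1.6)] [cite: Stichtenoth2009, Theorem 5.1.15 (e)] -/
theorem hasPoleOfOrderAt_of_abs_lt (hq : 1 < q) (hW : IsWeilFactorization q n Z P) {t₀ : ℚ}
    (ht : |t₀| < ((q : ℚ) ^ n)⁻¹) : HasPoleOfOrderAt Z t₀ 0 := by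
  refine hW.hasPoleOfOrderAt_zero_of_eval_ne_zero fun i => hW.eval_ne_zero_of_norm_ne i ?_
  have hq0 : (0 : ℝ) < q := by exact_mod_cast (zero_lt_one.trans hq)
  have hq1 : (1 : ℝ) ≤ q := by exact_mod_cast hq.le
  -- `q^{−n} ≤ q^{−i/2}` for `i ≤ 2n`
  have hle : (q : ℝ) ^ (-(n : ℝ)) ≤ (q : ℝ) ^ (-((i : ℕ) : ℝ) / 2) :=
    Real.rpow_le_rpow_of_exponent_le hq1 (by
      have hi2 : ((i : ℕ) : ℝ) ≤ 2 * n := by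
        exact_mod_cast (show (i : ℕ) ≤ 2 * n by have := i.isLt; omega)
      linarith)
  have hlt : ‖(algebraMap ℚ ℂ t₀)‖ < (q : ℝ) ^ (-(n : ℝ)) := by
    rw [norm_algebraMap_rat_complex', Real.rpow_neg hq0.le, Real.rpow_natCast]
    have h := (Rat.cast_lt (K := ℝ)).mpr ht
    rw [Rat.cast_abs, Rat.cast_inv, Rat.cast_pow, Rat.cast_natCast] at h
    exact h
  exact (hlt.trans_le hle).ne

end IsWeilFactorization

/-! ### §2 In `E`: `Z(X)` and `Z(X ⊗ 𝔽_{q^m})` off the weights -/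

namespace GaloisWeilCohomology

variable {k : Type u} [Field k] [Finite k] {K : Type v} [Field K] [CharZero K]
  {χ : Field.absoluteGaloisGroup k →* Kˣ} (E : GaloisWeilCohomology k K χ)
variable {d : ℕ} {X : SchemeOver k}

/-- **`Z(X, T)` has neither pole nor zero at `q^{−r}` for `r > dim X`** (no cohomology in degree `2r > 2 dim X`).
[cite: Deligne1974, Th. (1.6)] [cite: TateWoodsHole1965, §3] -/
theorem hasPoleOfOrderAt_zetaSeries_of_dim_lt (hE : E.HasLefschetzTraceFormula)
    (hχ : ((χ (arithFrob k) : Kˣ) : K) = Nat.card k) (hX : IsSmoothProjective d X)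
    (hRH : E.WeilRiemannHypothesisFor X d) {r : ℕ} (hr : d < r) :
    HasPoleOfOrderAt (zetaSeries X) (((Nat.card k : ℚ) ^ r)⁻¹) 0 := by
  obtain ⟨P, hP, hroots⟩ := hRH
  exact (isWeilFactorization_of_isIntegralModel E hE hχ hX hP hroots).hasPoleOfOrderAt_of_lt
    Finite.one_lt_card hr

/-- **`Z(X ⊗ 𝔽_{q^m}, T)` has neither pole nor zero at `(q^m)^{−r}` for `r > dim X`**, every `m ≥ 1`.
[cite: Deligne1974, Th. (1.6)] [cite: Stichtenoth2009, Theorem 5.1.15 (f)] [cite: TateWoodsHole1965, §3] -/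
theorem hasPoleOfOrderAt_zetaSeriesPow_of_dim_lt (hE : E.HasLefschetzTraceFormula)
    (hχ : ((χ (arithFrob k) : Kˣ) : K) = Nat.card k) (hX : IsSmoothProjective d X)
    (hRH : E.WeilRiemannHypothesisFor X d) {m : ℕ} (hm : 0 < m) {r : ℕ} (hr : d < r) :
    HasPoleOfOrderAt (zetaSeriesPow X m) ((((Nat.card k : ℚ) ^ m) ^ r)⁻¹) 0 := by
  obtain ⟨P, hP, hroots⟩ := hRH
  have h := (E.isWeilFactorization_pow hE hχ hX hP hroots hm).hasPoleOfOrderAt_of_lt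
    (Nat.one_lt_pow hm.ne' Finite.one_lt_card) hr
  rwa [Nat.cast_pow] at h

/-- **`Z(X, T)` has neither pole nor zero at any `t₀` with `|t₀| > 1`.** [cite: Deligne1974, Th. (1.6)] -/
theorem hasPoleOfOrderAt_zetaSeries_of_one_lt_abs (hE : E.HasLefschetzTraceFormula)
    (hχ : ((χ (arithFrob k) : Kˣ) : K) = Nat.card k) (hX : IsSmoothProjective d X)
    (hRH : E.WeilRiemannHypothesisFor X d) {t₀ : ℚ} (ht : 1 < |t₀|) :
    HasPoleOfOrderAt (zetaSeries X) t₀ 0 := by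
  obtain ⟨P, hP, hroots⟩ := hRH
  exact (isWeilFactorization_of_isIntegralModel E hE hχ hX hP hroots).hasPoleOfOrderAt_of_one_lt_abs
    Finite.one_lt_card ht

/-- **`Z(X ⊗ 𝔽_{q^m}, T)` has neither pole nor zero at any `t₀` with `|t₀| > 1`**, every `m ≥ 1`.
[cite: Deligne1974, Th. (1.6)] [cite: Stichtenoth2009, Theorem 5.1.15 (e), (f)] -/
theorem hasPoleOfOrderAt_zetaSeriesPow_of_one_lt_abs (hE : E.HasLefschetzTraceFormula)
    (hχ : ((χ (arithFrob k) : Kˣ) : K) = Nat.card k) (hX : IsSmoothProjective d X)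
    (hRH : E.WeilRiemannHypothesisFor X d) {m : ℕ} (hm : 0 < m) {t₀ : ℚ} (ht : 1 < |t₀|) :
    HasPoleOfOrderAt (zetaSeriesPow X m) t₀ 0 := by
  obtain ⟨P, hP, hroots⟩ := hRH
  exact (E.isWeilFactorization_pow hE hχ hX hP hroots hm).hasPoleOfOrderAt_of_one_lt_abs
    (Nat.one_lt_pow hm.ne' Finite.one_lt_card) ht

/-- **`Z(X, T)` has neither pole nor zero at any `t₀` with `|t₀| < q^{−dim X}`.** [cite: Deligne1974, Th. (1.6)] -/
theorem hasPoleOfOrderAt_zetaSeries_of_abs_lt (hE : E.HasLefschetzTraceFormula)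
    (hχ : ((χ (arithFrob k) : Kˣ) : K) = Nat.card k) (hX : IsSmoothProjective d X)
    (hRH : E.WeilRiemannHypothesisFor X d) {t₀ : ℚ} (ht : |t₀| < ((Nat.card k : ℚ) ^ d)⁻¹) :
    HasPoleOfOrderAt (zetaSeries X) t₀ 0 := by
  obtain ⟨P, hP, hroots⟩ := hRH
  exact (isWeilFactorization_of_isIntegralModel E hE hχ hX hP hroots).hasPoleOfOrderAt_of_abs_lt
    Finite.one_lt_card ht

/-- **`Z(X ⊗ 𝔽_{q^m}, T)` has neither pole nor zero at any `t₀` with `|t₀| < (q^m)^{−dim X}`**, every `m ≥ 1`.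
[cite: Deligne1974, Th. (1.6)] [cite: Stichtenoth2009, Theorem 5.1.15 (e), (f)] -/
theorem hasPoleOfOrderAt_zetaSeriesPow_of_abs_lt (hE : E.HasLefschetzTraceFormula)
    (hχ : ((χ (arithFrob k) : Kˣ) : K) = Nat.card k) (hX : IsSmoothProjective d X)
    (hRH : E.WeilRiemannHypothesisFor X d) {m : ℕ} (hm : 0 < m) {t₀ : ℚ}
    (ht : |t₀| < (((Nat.card k : ℚ) ^ m) ^ d)⁻¹) :
    HasPoleOfOrderAt (zetaSeriesPow X m) t₀ 0 := by
  obtain ⟨P, hP, hroots⟩ := hRH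
  have ht' : |t₀| < ((((Nat.card k ^ m : ℕ) : ℚ)) ^ d)⁻¹ := by rwa [Nat.cast_pow]
  exact (E.isWeilFactorization_pow hE hχ hX hP hroots hm).hasPoleOfOrderAt_of_abs_lt
    (Nat.one_lt_pow hm.ne' Finite.one_lt_card) ht'

/-! ### §3 The top and bottom poles of `Z((X × ℙⁿ) ⊗ 𝔽_{q^m}, T)` -/

/-- **`ord_{T=(q^m)^{−(d+n)}} Z((X × ℙⁿ) ⊗ 𝔽_{q^m}, T) = dim H^{2d}(X)(d)_{(φ_d(Fᵐ)),1} = ord_{(q^m)^{−d}} Z(X ⊗ 𝔽_{q^m})`**: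
in g52-#8's `Σ_{i≤n} ord_{(q^m)^{−(d+n−i)}} Z_m(X)` only `i = n` lies within the weights of `X`.
[cite: TateWoodsHole1965, §3] [cite: Kahn2020, Prop. 2.3 (4), (5) and §6.14 Conj. 6.52] -/
theorem hasPoleOfOrderAt_zetaSeriesPow_tensor_projectiveSpace_top (hE : E.HasLefschetzTraceFormula)
    (hχ : ((χ (arithFrob k) : Kˣ) : K) = Nat.card k) (hX : IsSmoothProjective d X)
    (hRH : E.WeilRiemannHypothesisFor X d) (n : ℕ) {m : ℕ} (hm : 0 < m) :
    HasPoleOfOrderAt (zetaSeriesPow (X ⊗ projectiveSpace n k) m) ((((Nat.card k : ℚ) ^ m) ^ (d + n))⁻¹)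
      (Module.finrank K (Module.End.maxGenEigenspace (E.ρTwist X (2 * d) d (geomFrob k ^ m)) 1)) := by
  have hq : ((Nat.card k : ℚ) ^ m) ≠ 0 := pow_ne_zero _ (Nat.cast_ne_zero.mpr Nat.card_pos.ne')
  have h := hasPoleOfOrderAt_zetaSeriesPow_tensor_projectiveSpace n X hm
    (t₀ := ((((Nat.card k : ℚ) ^ m) ^ (d + n))⁻¹))
    (ρ := fun i => if i = n then
      Module.finrank K (Module.End.maxGenEigenspace (E.ρTwist X (2 * d) d (geomFrob k ^ m)) 1) else 0)
    (fun i hi => by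
      have hin : i ≤ n := by rw [Finset.mem_range] at hi; omega
      -- the point `(q^m)ⁱ · (q^m)^{−(d+n)} = (q^m)^{−(d+n−i)}`
      obtain ⟨j, hj⟩ := Nat.exists_eq_add_of_le hin
      have hpt : (((Nat.card k : ℚ) ^ m) ^ i) * ((((Nat.card k : ℚ) ^ m) ^ (d + n))⁻¹) =
          ((((Nat.card k : ℚ) ^ m) ^ (d + j))⁻¹) := by
        rw [hj, show d + (i + j) = i + (d + j) by ring, pow_add, mul_inv, ← mul_assoc,
          mul_inv_cancel₀ (pow_ne_zero _ hq), one_mul]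
      rw [hpt]
      by_cases hi' : i = n
      · rw [if_pos hi']
        have hj0 : j = 0 := by omega
        rw [hj0, add_zero]
        exact E.hasPoleOfOrderAt_zetaSeriesPow hE hχ hX hRH le_rfl hm
      · rw [if_neg hi']
        exact E.hasPoleOfOrderAt_zetaSeriesPow_of_dim_lt hE hχ hX hRH hm (by omega))
  rwa [Finset.sum_ite_eq', if_pos (Finset.mem_range.mpr (Nat.lt_succ_self n))] at h

/-- **`ord_{T=1} Z((X × ℙⁿ) ⊗ 𝔽_{q^m}, T) = dim H⁰(X)_{(φ₀(Fᵐ)),1} = ord_{T=1} Z(X ⊗ 𝔽_{q^m})`**: in g52-#8's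
`Σ_{i≤n} ord_{(q^m)ⁱ} Z_m(X)` only `i = 0` lies within the weights (`|(q^m)ⁱ| > 1` for `i ≥ 1`).
[cite: TateWoodsHole1965, §3] [cite: Kahn2020, Prop. 2.3 (4), (5)] -/
theorem hasPoleOfOrderAt_zetaSeriesPow_tensor_projectiveSpace_one (hE : E.HasLefschetzTraceFormula)
    (hχ : ((χ (arithFrob k) : Kˣ) : K) = Nat.card k) (hX : IsSmoothProjective d X)
    (hRH : E.WeilRiemannHypothesisFor X d) (n : ℕ) {m : ℕ} (hm : 0 < m) :
    HasPoleOfOrderAt (zetaSeriesPow (X ⊗ projectiveSpace n k) m) 1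
      (Module.finrank K (Module.End.maxGenEigenspace (E.ρTwist X (2 * 0) 0 (geomFrob k ^ m)) 1)) := by
  have hqm : 1 < Nat.card k ^ m := Nat.one_lt_pow hm.ne' Finite.one_lt_card
  have h1 : (1 : ℚ) < (Nat.card k : ℚ) ^ m := by exact_mod_cast hqm
  have h := hasPoleOfOrderAt_zetaSeriesPow_tensor_projectiveSpace n X hm (t₀ := 1)
    (ρ := fun i => if i = 0 then
      Module.finrank K (Module.End.maxGenEigenspace (E.ρTwist X (2 * 0) 0 (geomFrob k ^ m)) 1) else 0)
    (fun i _ => by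
      rw [mul_one]
      by_cases hi : i = 0
      · rw [if_pos hi, hi]
        have h0 := E.hasPoleOfOrderAt_zetaSeriesPow hE hχ hX hRH (Nat.zero_le d) hm
        rwa [pow_zero, inv_one] at h0
      · rw [if_neg hi]
        refine E.hasPoleOfOrderAt_zetaSeriesPow_of_one_lt_abs hE hχ hX hRH hm ?_
        rw [abs_of_pos (by positivity)]
        exact one_lt_pow₀ h1 hi)
  rwa [Finset.sum_ite_eq', if_pos (Finset.mem_range.mpr (Nat.succ_pos n))] at h

/-- **No pole and no zero of `Z((X × ℙⁿ) ⊗ 𝔽_{q^m}, T)` at `(q^m)^{−r}` for `r > d + n`** (beyond `dim(X × ℙⁿ)`;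
every summand of g52-#8's formula vanishes). [cite: Deligne1974, Th. (1.6)] [cite: TateWoodsHole1965, §3] -/
theorem hasPoleOfOrderAt_zetaSeriesPow_tensor_projectiveSpace_of_lt (hE : E.HasLefschetzTraceFormula)
    (hχ : ((χ (arithFrob k) : Kˣ) : K) = Nat.card k) (hX : IsSmoothProjective d X)
    (hRH : E.WeilRiemannHypothesisFor X d) (n : ℕ) {m : ℕ} (hm : 0 < m) {r : ℕ} (hr : d + n < r) :
    HasPoleOfOrderAt (zetaSeriesPow (X ⊗ projectiveSpace n k) m) ((((Nat.card k : ℚ) ^ m) ^ r)⁻¹) 0 := by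
  have hq : ((Nat.card k : ℚ) ^ m) ≠ 0 := pow_ne_zero _ (Nat.cast_ne_zero.mpr Nat.card_pos.ne')
  have h := hasPoleOfOrderAt_zetaSeriesPow_tensor_projectiveSpace n X hm
    (t₀ := ((((Nat.card k : ℚ) ^ m) ^ r)⁻¹)) (ρ := fun _ => 0)
    (fun i hi => by
      have hir : i ≤ r := by rw [Finset.mem_range] at hi; omega
      obtain ⟨j, hj⟩ := Nat.exists_eq_add_of_le hir
      have hpt : (((Nat.card k : ℚ) ^ m) ^ i) * ((((Nat.card k : ℚ) ^ m) ^ r)⁻¹) =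
          ((((Nat.card k : ℚ) ^ m) ^ j)⁻¹) := by
        rw [hj, pow_add, mul_inv, ← mul_assoc, mul_inv_cancel₀ (pow_ne_zero _ hq), one_mul]
      rw [hpt]
      exact E.hasPoleOfOrderAt_zetaSeriesPow_of_dim_lt hE hχ hX hRH hm
        (by rw [Finset.mem_range] at hi; omega))
  rwa [Finset.sum_const_zero] at h

end GaloisWeilCohomology

end Literature.AlgebraicGeometry.Motives

end
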